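import Summits.QuantumFields.YangMills.Theorems.BalabanUVNodesN14ConvexFibreWindow
import Summits.QuantumFields.YangMills.Theorems.BalabanUVNodesN14ConvexFibreStep

/-!
# BalabanUVNodes ∕ node N14 = NE1′ — THE SOURCE TILT OF A COMPOSITE LAW: tilting `ν ⊗ₘ κ` by an observable = tilting the background by the
# FIBRE CUMULANT (the born dressed action term) and the fibre by the observable; hence the convex step survives the tilt with modulus `λ − l₀M`

Cell `pub-ymgap`, HUMAN RULING D-0062 (Track A at full width), seat `pub-ymgap-dag-n14-c` (R134 ACCELERATION, strategy s1), generation 4;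
route `Summits/QuantumFields/YangMills/Theses/BalabanUVNodes.lean` (cluster K3′ `SpineGivenEndpointR12`, `--supports … --as helper`); venue
ruling R424 (`YangMills/Theorems`, namespace `YMDAG.N14.ConvexFibreTilt`).  Fifth file of the convex-fibre engine (A `…Engine`, B `…Window`,
C `…Step`, D `…Box`).  ADDITIVE — imports B and C; THEOREMS ONLY (0 `def`), modifies nothing.

WHY.  The variance socket and the dressed generating function live under the SOURCE-TILTED law `μ.tilted (s·G)`.  For ONE fibre, file B
shows the tilt keeps a modulus `λ − l₀M`.  For the TOWER `μ = ν ⊗ₘ κ` (background ⊗ fibre) this file proves the structural identity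
`(ν ⊗ₘ κ).tilted f = ν.tilted Λ_f ⊗ₘ κ_f`, `Λ_f b = log ∫ e^{f(b,·)} dκ b` (the fibre cumulant = the born dressed action term of one step,
`B16DressedActionTerm.dressLog`'s real twin), `κ_f b = (κ b).tilted f(b,·)` — so a tilted composite law is again a composite law whose
fibres are the tilted fibres (convex with modulus `λ − l₀M`) and whose background is tilted by the DRESSED ACTION TERM: the recursion of NE1′.

WHAT THIS IS.
* §1 [folklore, Fubini on rectangles] `integral_exp_compProd_eq` (`∫ e^f d(ν ⊗ₘ κ) = ∫ (∫ e^{f(b,·)} dκ b) dν`), **`compProd_tilted`** — for `ν`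
  a probability law, `κ` a Markov kernel, `f` measurable and bounded, and ANY Markov kernel `η` with `η b = (κ b).tilted f(b,·)` (a measurable
  version of the tilted fibres — one always exists, `exists_tiltedKernel`, Mathlib `Kernel.withDensity`): `(ν ⊗ₘ κ).tilted f = (ν.tilted fun b => log ∫ e^{f(b,x)} dκ b) ⊗ₘ η` (π-system of
  rectangles, `ext_of_generate_finite`).
* §2 THE TILTED CONVEX STEP [folklore ∘ files B∕C]: `tiltedFibre_eq_of_uniformlyConvex` (for `κ b = e^{−V(b,·)}dx∕Z_b` the tilted fibre is
  `e^{−(V − s·G)(b,·)}dx∕Z′_b`), **`hasSubgaussianMGF_tilted_compProd_of_uniformlyConvex`** — on the window `|s| ≤ l₀`, `l₀M < λ` (two-sided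
  letter `M` on every `G (b,·)`), ANY bounded observable `F` with `F (b,·) ∈ C¹`, fibre gradient `≤ L_F`, whose TILTED-fibre average is
  sub-Gaussian `c` under the background law tilted by the fibre cumulant, is sub-Gaussian about its mean under `(ν ⊗ₘ κ).tilted (s·G)` with
  parameter `c + L_F²∕(λ − l₀M)`; `bornCumulant_tilted_step_le`.
* §3 SUB-GAUSSIAN ⇒ VARIANCE [folklore; not in Mathlib]: **`integral_sq_le_of_hasSubgaussianMGF`**
  (`HasSubgaussianMGF X c μ ⇒ ∫X² dμ ≤ c`), `variance_le_of_hasSubgaussianMGF`; hence **`variance_tilted_compProd_le_of_uniformlyConvex`** — the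
  VARIANCE SOCKET'S letter for the TILTED COMPOSITE law: `Var[F; (ν ⊗ₘ κ).tilted (s·G)] ≤ c + L_F²∕(λ − l₀M)` on the window.

WHAT THIS IS NOT.  Everything here is PROVED (0 `sorry`, 0 named facts).  HYPOTHESES in any application: Bałaban's fibre actions `λ`-convex
uniformly in the history with the observable's two-sided letter `M` (NODE O positivity); the base hypothesis under the background law tilted
by the dressed action term is the same statement one level up (the recursion is the user's; its convexity through the steps is the NE7b
convexity road's `SupConvexStepIntegrated.integratedStep_closure`, not used here).  Nothing of Bałaban's instantiated; N14 NOT discharged;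
count-neutral.  One finite four-torus programme at fixed ε; NOT ℝ⁴, NOT OS, NOT a mass gap, NOT Clay.
-/

noncomputable section

namespace YMDAG.N14.ConvexFibreTilt

open MeasureTheory ProbabilityTheory Set Filter Topology
open scoped RealInnerProductSpace ENNReal NNReal
open Literature.Analysis.FunctionSpaces (isProbabilityMeasure_tilted_neg)
open YMDAG.N14.CovGradEngine (bornCumulant_le_of_hasSubgaussianMGF)
open YMDAG.N14.ConvexFibreEngine (hasSubgaussianMGF_of_uniformlyConvex)
open YMDAG.N14.ConvexFibreWindow (firstOrder_sub_mul integrable_exp_neg_sub_mul tilted_mul_eq)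
open YMDAG.N14.ConvexFibreStep (hasSubgaussianMGF_compProd_of_fibre)

/-! ## §1 The tilt of a composite law -/
section Tilt

variable {B E : Type*} [MeasurableSpace B] [MeasurableSpace E] {ν : Measure B} [IsProbabilityMeasure ν] {κ η : Kernel B E}
  [IsMarkovKernel κ] [IsMarkovKernel η] {f : B × E → ℝ} {Cf : ℝ}

omit [IsMarkovKernel η] in
/-- The fibrewise exponential moment `Z_b = ∫ e^{f(b,·)} dκ b` of a bounded measurable `f` lies in `[e^{−C}, e^{C}]`, is measurable in `b`,
and `e^{Λ b} = Z_b` for `Λ b = log Z_b`. [folklore] -/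
theorem fibreMass_pos_measurable (hf : Measurable f) (hfb : ∀ p, |f p| ≤ Cf) :
    (∀ b, Real.exp (-Cf) ≤ ∫ x, Real.exp (f (b, x)) ∂(κ b)) ∧ (∀ b, ∫ x, Real.exp (f (b, x)) ∂(κ b) ≤ Real.exp Cf) ∧
      Measurable (fun b => ∫ x, Real.exp (f (b, x)) ∂(κ b)) := by
  have hm : Measurable fun p : B × E => Real.exp (f p) := Real.measurable_exp.comp hf
  have hint : ∀ b, Integrable (fun x => Real.exp (f (b, x))) (κ b) := fun b =>
    (integrable_const (Real.exp Cf)).mono' (hm.comp measurable_prodMk_left).aestronglyMeasurable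
      (Eventually.of_forall fun x => by
        rw [Real.norm_eq_abs, abs_of_pos (Real.exp_pos _), Real.exp_le_exp]
        exact (le_abs_self _).trans (hfb (b, x)))
  refine ⟨fun b => ?_, fun b => ?_, (hm.stronglyMeasurable.integral_kernel_prod_right' (κ := κ)).measurable⟩
  · have h := integral_mono (integrable_const (Real.exp (-Cf))) (hint b) fun x => by
      show Real.exp (-Cf) ≤ Real.exp (f (b, x))
      exact Real.exp_le_exp.2 (abs_le.1 (hfb (b, x))).1
    simpa using h
  · have h := integral_mono (hint b) (integrable_const (Real.exp Cf)) fun x => by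
      show Real.exp (f (b, x)) ≤ Real.exp Cf
      exact Real.exp_le_exp.2 ((le_abs_self _).trans (hfb (b, x)))
    simpa using h

omit [IsMarkovKernel η] in
/-- **FUBINI FOR THE EXPONENTIAL MOMENT** [folklore]: `∫ e^f d(ν ⊗ₘ κ) = ∫ (∫ e^{f(b,x)} dκ b) dν` for bounded measurable `f`. -/
theorem integral_exp_compProd_eq (hf : Measurable f) (hfb : ∀ p, |f p| ≤ Cf) :
    ∫ p, Real.exp (f p) ∂(ν ⊗ₘ κ) = ∫ b, (∫ x, Real.exp (f (b, x)) ∂(κ b)) ∂ν :=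
  Measure.integral_compProd ((integrable_const (Real.exp Cf)).mono' (Real.measurable_exp.comp hf).aestronglyMeasurable
    (Eventually.of_forall fun p => by
      rw [Real.norm_eq_abs, abs_of_pos (Real.exp_pos _), Real.exp_le_exp]
      exact (le_abs_self _).trans (hfb p)))

omit [IsProbabilityMeasure ν] [IsMarkovKernel η] in
/-- **A MEASURABLE VERSION OF THE TILTED FIBRES ALWAYS EXISTS** [folklore]: for `κ` Markov and `f` measurable bounded, the kernel
`κ.withDensity (fun b x => ofReal (e^{f(b,x)} ∕ ∫ e^{f(b,·)} dκ b))` is a Markov kernel `η` with `η b = (κ b).tilted f(b,·)` for every `b`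
(Mathlib `Kernel.withDensity`; the density is jointly measurable because the fibre mass is measurable in `b`). -/
theorem exists_tiltedKernel (hf : Measurable f) (hfb : ∀ p, |f p| ≤ Cf) :
    ∃ η : Kernel B E, IsMarkovKernel η ∧ ∀ b, η b = (κ b).tilted fun x => f (b, x) := by
  obtain ⟨hZlo, _, hZm⟩ := fibreMass_pos_measurable (κ := κ) hf hfb
  set d : B → E → ℝ≥0∞ := fun b x => ENNReal.ofReal (Real.exp (f (b, x)) / ∫ y, Real.exp (f (b, y)) ∂(κ b)) with hd
  have hdm : Measurable (Function.uncurry d) := by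
    have h1 : Measurable fun p : B × E => Real.exp (f p) / ∫ y, Real.exp (f (p.1, y)) ∂(κ p.1) :=
      (Real.measurable_exp.comp hf).div (hZm.comp measurable_fst)
    exact h1.ennreal_ofReal
  have happly : ∀ b, κ.withDensity d b = (κ b).tilted fun x => f (b, x) := fun b => by
    rw [Kernel.withDensity_apply κ hdm b]
    rfl
  have hint : ∀ b, Integrable (fun x => Real.exp (f (b, x))) (κ b) := fun b =>
    (integrable_const (Real.exp Cf)).mono' ((Real.measurable_exp.comp hf).comp measurable_prodMk_left).aestronglyMeasurable
      (Eventually.of_forall fun x => by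
        rw [Real.norm_eq_abs, abs_of_pos (Real.exp_pos _), Real.exp_le_exp]
        exact (le_abs_self _).trans (hfb (b, x)))
  refine ⟨κ.withDensity d, ⟨fun b => ?_⟩, happly⟩
  rw [happly b]
  exact isProbabilityMeasure_tilted (hint b)

/-- **THE TILT OF A COMPOSITE LAW** [folklore].  `ν` a probability law on the background, `κ` a Markov fibre kernel, `f` measurable and
bounded, `η` ANY Markov kernel version of the tilted fibres (`η b = (κ b).tilted f(b,·)`).  Then
`(ν ⊗ₘ κ).tilted f = (ν.tilted Λ) ⊗ₘ η` with `Λ b = log ∫ e^{f(b,x)} dκ b` THE FIBRE CUMULANT — the born dressed action term of the step.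
(Both sides are finite measures agreeing on measurable rectangles: `e^{Λ b}∕Z · e^{f(b,x)}∕e^{Λ b} = e^{f(b,x)}∕Z` with
`Z = ∫ e^f d(ν ⊗ₘ κ) = ∫ e^{Λ} dν` by Fubini.) -/
theorem compProd_tilted (hf : Measurable f) (hfb : ∀ p, |f p| ≤ Cf) (hη : ∀ b, η b = (κ b).tilted fun x => f (b, x)) :
    (ν ⊗ₘ κ).tilted f = (ν.tilted fun b => Real.log (∫ x, Real.exp (f (b, x)) ∂(κ b))) ⊗ₘ η := by
  obtain ⟨hZlo, hZhi, hZm⟩ := fibreMass_pos_measurable (κ := κ) hf hfb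
  set Zb : B → ℝ := fun b => ∫ x, Real.exp (f (b, x)) ∂(κ b) with hZb
  set Λ : B → ℝ := fun b => Real.log (Zb b) with hΛ
  have hZpos : ∀ b, 0 < Zb b := fun b => (Real.exp_pos _).trans_le (hZlo b)
  have hexpΛ : ∀ b, Real.exp (Λ b) = Zb b := fun b => Real.exp_log (hZpos b)
  have hem : Measurable fun p : B × E => Real.exp (f p) := Real.measurable_exp.comp hf
  -- the total mass `Z`
  set Z : ℝ := ∫ p, Real.exp (f p) ∂(ν ⊗ₘ κ) with hZ
  have hZeq : ∫ b, Real.exp (Λ b) ∂ν = Z := by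
    rw [hZ, integral_exp_compProd_eq hf hfb]
    exact integral_congr_ae (Eventually.of_forall fun b => hexpΛ b)
  have hZpos' : 0 < Z := by
    rw [← hZeq]
    exact integral_exp_pos ((integrable_const (Real.exp Cf)).mono' (Real.measurable_exp.comp (Real.measurable_log.comp hZm)).aestronglyMeasurable
      (Eventually.of_forall fun b => by
        rw [Real.norm_eq_abs, abs_of_pos (Real.exp_pos _), hexpΛ b]; exact hZhi b))
  -- both sides are probability measures
  have hintf : Integrable (fun p : B × E => Real.exp (f p)) (ν ⊗ₘ κ) :=
    (integrable_const (Real.exp Cf)).mono' hem.aestronglyMeasurable (Eventually.of_forall fun p => by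
      rw [Real.norm_eq_abs, abs_of_pos (Real.exp_pos _), Real.exp_le_exp]; exact (le_abs_self _).trans (hfb p))
  have hintΛ : Integrable (fun b => Real.exp (Λ b)) ν :=
    (integrable_const (Real.exp Cf)).mono' (Real.measurable_exp.comp (Real.measurable_log.comp hZm)).aestronglyMeasurable
      (Eventually.of_forall fun b => by rw [Real.norm_eq_abs, abs_of_pos (Real.exp_pos _), hexpΛ b]; exact hZhi b)
  haveI : IsProbabilityMeasure ((ν ⊗ₘ κ).tilted f) := isProbabilityMeasure_tilted hintf
  haveI : IsProbabilityMeasure (ν.tilted Λ) := isProbabilityMeasure_tilted hintΛ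
  -- compare on rectangles
  refine ext_of_generate_finite _ generateFrom_prod.symm isPiSystem_prod (fun r hr => ?_) (by simp)
  obtain ⟨s, hs, t, ht, rfl⟩ := hr
  have hs' : MeasurableSet s := hs
  have ht' : MeasurableSet t := ht
  have hmeasZ : Measurable fun p : B × E => ENNReal.ofReal (Real.exp (f p) / Z) := (hem.div_const Z).ennreal_ofReal
  rw [tilted_apply' _ _ (hs'.prod ht'), Measure.setLIntegral_compProd hmeasZ hs' ht', Measure.compProd_apply_prod hs' ht',
    setLIntegral_tilted' _ _ hs']
  refine setLIntegral_congr_fun hs' (fun b _ => ?_)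
  have hmeas_b : Measurable fun x => ENNReal.ofReal (Real.exp (f (b, x)) / Zb b) :=
    ((hem.comp measurable_prodMk_left).div_const _).ennreal_ofReal
  rw [hη b, tilted_apply' _ _ ht', ← lintegral_const_mul _ hmeas_b]
  refine setLIntegral_congr_fun ht' (fun x _ => ?_)
  have h0 : 0 ≤ Real.exp (Λ b) / ∫ b', Real.exp (Λ b') ∂ν := div_nonneg (Real.exp_pos _).le (integral_nonneg fun _ => (Real.exp_pos _).le)
  rw [← ENNReal.ofReal_mul h0]
  congr 1
  rw [hexpΛ b, hZeq]
  have hZb0 : Zb b ≠ 0 := (hZpos b).ne'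
  have hZ0 : Z ≠ 0 := hZpos'.ne'
  show Real.exp (f (b, x)) / Z = Zb b / Z * (Real.exp (f (b, x)) / Zb b)
  field_simp

end Tilt

/-! ## §2 The tilted convex step: the engine under `(ν ⊗ₘ κ).tilted (s·G)` on the window `|s| ≤ l₀`, `l₀M < λ` -/
section TiltedStep

variable {B : Type*} [MeasurableSpace B] {n : ℕ} {ν : Measure B} [IsProbabilityMeasure ν]
  {κ η : Kernel B (EuclideanSpace ℝ (Fin n))} [IsMarkovKernel κ] [IsMarkovKernel η]
  {V G F : B × EuclideanSpace ℝ (Fin n) → ℝ} {lam M l₀ s B₀ BF LF : ℝ}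

omit [IsProbabilityMeasure ν] [IsMarkovKernel κ] [IsMarkovKernel η] in
/-- **THE TILTED FIBRE OF A CONVEX FIBRE IS A CONVEX FIBRE** [folklore ∘ file B's `tilted_mul_eq`]: if `κ b = e^{−V(b,·)}dx∕Z_b` and `η` is a
version of the tilted fibres `η b = (κ b).tilted (s·G(b,·))`, then `η b = e^{−(V − s·G)(b,·)}dx∕Z′_b`. -/
theorem tiltedFibre_eq_of_uniformlyConvex
    (hκ : ∀ b, κ b = (volume : Measure (EuclideanSpace ℝ (Fin n))).tilted fun x => -V (b, x))
    (hZ : ∀ b, Integrable fun x => Real.exp (-V (b, x))) (hη : ∀ b, η b = (κ b).tilted fun x => s * G (b, x)) (b : B) :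
    η b = (volume : Measure (EuclideanSpace ℝ (Fin n))).tilted fun x => -(V (b, x) - s * G (b, x)) := by
  rw [hη b, hκ b]
  exact tilted_mul_eq (V := fun x => V (b, x)) (G := fun x => G (b, x)) (hZ b) s

omit [IsMarkovKernel η] in
/-- The background law tilted by the fibre cumulant of a bounded source is a probability law. [folklore] -/
theorem isProbabilityMeasure_tilted_fibreCumulant (hGm : Measurable G) (hGb : ∀ p, |G p| ≤ B₀) (s : ℝ) :
    IsProbabilityMeasure (ν.tilted fun b => Real.log (∫ x, Real.exp (s * G (b, x)) ∂(κ b))) := by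
  have hf : Measurable fun p : B × EuclideanSpace ℝ (Fin n) => s * G p := hGm.const_mul s
  have hfb : ∀ p : B × EuclideanSpace ℝ (Fin n), |s * G p| ≤ |s| * B₀ := fun p => by
    rw [abs_mul]; exact mul_le_mul_of_nonneg_left (hGb p) (abs_nonneg _)
  obtain ⟨hZlo, hZhi, hZm⟩ := fibreMass_pos_measurable (κ := κ) hf hfb
  have hZpos : ∀ b, 0 < ∫ x, Real.exp (s * G (b, x)) ∂(κ b) := fun b => (Real.exp_pos _).trans_le (hZlo b)
  refine isProbabilityMeasure_tilted ((integrable_const (Real.exp (|s| * B₀))).mono'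
    (Real.measurable_exp.comp (Real.measurable_log.comp hZm)).aestronglyMeasurable (Eventually.of_forall fun b => ?_))
  rw [Real.norm_eq_abs, abs_of_pos (Real.exp_pos _), Real.exp_log (hZpos b)]
  exact hZhi b

/-- **THE TILTED CONVEX STEP** [folklore ∘ files A∕B∕C; cite: BakryGentilLedoux2014, Prop. 5.4.1 + Cor. 5.7.2 — PROVED in the tree].  Background
law `ν`, convex fibre kernel `κ b = e^{−V(b,·)}dx∕Z_b` (every `V (b,·) ∈ C¹`, `λ`-uniformly convex, `e^{−V(b,·)}` integrable); tilt source `G`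
measurable with `|G| ≤ B₀`, every `G (b,·) ∈ C¹` with the two-sided first-order letter `M`; window `|s| ≤ l₀`, `l₀M < λ`; `η` any Markov version
of the tilted fibres.  Let `F` be measurable with `|F| ≤ B_F`, every `F (b,·) ∈ C¹` with fibre gradient `≤ L_F` (`L_F > 0`), and suppose its
TILTED-fibre average `b ↦ ∫ F (b,x) ∂(η b)` is sub-Gaussian about its mean with parameter `c` under the background law tilted by the fibre
cumulant `Λ_s b = log ∫ e^{sG(b,·)} dκ b` (the born dressed action term).  Then under the SOURCE-TILTED composite law `(ν ⊗ₘ κ).tilted (s·G)`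
the observable `F` is sub-Gaussian about its mean with parameter `c + L_F²∕(λ − l₀M)` — the step of file C at the tilted modulus, through the
identity `compProd_tilted`. -/
theorem hasSubgaussianMGF_tilted_compProd_of_uniformlyConvex {c : ℝ≥0}
    (hκ : ∀ b, κ b = (volume : Measure (EuclideanSpace ℝ (Fin n))).tilted fun x => -V (b, x))
    (hVc : ∀ b, ContDiff ℝ 1 fun x => V (b, x))
    (hV : ∀ b (x y : EuclideanSpace ℝ (Fin n)), V (b, x) + ⟪gradient (fun z => V (b, z)) x, y - x⟫ + lam / 2 * ‖y - x‖ ^ 2 ≤ V (b, y))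
    (hZ : ∀ b, Integrable fun x => Real.exp (-V (b, x))) (hGm : Measurable G) (hG : ∀ b, ContDiff ℝ 1 fun x => G (b, x))
    (hGb : ∀ p, |G p| ≤ B₀)
    (hGlo : ∀ b (x y : EuclideanSpace ℝ (Fin n)), G (b, x) + ⟪gradient (fun z => G (b, z)) x, y - x⟫ - M / 2 * ‖y - x‖ ^ 2 ≤ G (b, y))
    (hGup : ∀ b (x y : EuclideanSpace ℝ (Fin n)), G (b, y) ≤ G (b, x) + ⟪gradient (fun z => G (b, z)) x, y - x⟫ + M / 2 * ‖y - x‖ ^ 2)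
    (hlM : l₀ * M < lam) (hs : |s| ≤ l₀) (hη : ∀ b, η b = (κ b).tilted fun x => s * G (b, x))
    (hFm : Measurable F) (hF : ∀ b, ContDiff ℝ 1 fun x => F (b, x)) (hFb : ∀ p, |F p| ≤ BF)
    (hFD : ∀ b x, ‖fderiv ℝ (fun z => F (b, z)) x‖ ≤ LF) (hLF : 0 < LF)
    (hbase : HasSubgaussianMGF
      (fun b => (∫ x, F (b, x) ∂(η b)) - ∫ b', (∫ x, F (b', x) ∂(η b')) ∂(ν.tilted fun b => Real.log (∫ x, Real.exp (s * G (b, x)) ∂(κ b))))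
      c (ν.tilted fun b => Real.log (∫ x, Real.exp (s * G (b, x)) ∂(κ b)))) :
    HasSubgaussianMGF (fun p => F p - ∫ q, F q ∂((ν ⊗ₘ κ).tilted fun p => s * G p))
      (c + ⟨LF ^ 2 / (lam - l₀ * M), by have := sub_pos.2 hlM; positivity⟩) ((ν ⊗ₘ κ).tilted fun p => s * G p) := by
  have hfb : ∀ p : B × EuclideanSpace ℝ (Fin n), |s * G p| ≤ |s| * B₀ := fun p => by
    rw [abs_mul]; exact mul_le_mul_of_nonneg_left (hGb p) (abs_nonneg _)
  rw [compProd_tilted (ν := ν) (κ := κ) (η := η) (hGm.const_mul s) hfb hη]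
  haveI := isProbabilityMeasure_tilted_fibreCumulant (ν := ν) (κ := κ) hGm hGb s
  refine hasSubgaussianMGF_compProd_of_fibre hFm hFb hbase ?_
  -- the tilted fibres are `(λ − l₀M)`-convex fibres: file C's fibre bound at the tilted modulus
  exact YMDAG.N14.ConvexFibreStep.fibre_mgf_le_of_uniformlyConvex (V := fun p => V p - s * G p) (sub_pos.2 hlM)
    (tiltedFibre_eq_of_uniformlyConvex hκ hZ hη) (fun b => (hVc b).continuous.sub (continuous_const.mul (hG b).continuous))
    (fun b => firstOrder_sub_mul ((hVc b).differentiable one_ne_zero) ((hG b).differentiable one_ne_zero) (hV b) (hGlo b) (hGup b) hs)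
    (fun b => integrable_exp_neg_sub_mul (hVc b).continuous (hG b).continuous (fun x => hGb (b, x)) (hZ b) s) hF hFb hFD hLF

/-- **THE BORN CUMULANT OF THE TILTED STEP** [folklore]: under the hypotheses of `hasSubgaussianMGF_tilted_compProd_of_uniformlyConvex`, with
`μ_s = (ν ⊗ₘ κ).tilted (s·G)`, `cgf F μ_s t − t·∫F dμ_s ≤ (c + L_F²∕(λ − l₀M))·t²∕2` for every real `t`. -/
theorem bornCumulant_tilted_step_le {c : ℝ≥0}
    (hκ : ∀ b, κ b = (volume : Measure (EuclideanSpace ℝ (Fin n))).tilted fun x => -V (b, x))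
    (hVc : ∀ b, ContDiff ℝ 1 fun x => V (b, x))
    (hV : ∀ b (x y : EuclideanSpace ℝ (Fin n)), V (b, x) + ⟪gradient (fun z => V (b, z)) x, y - x⟫ + lam / 2 * ‖y - x‖ ^ 2 ≤ V (b, y))
    (hZ : ∀ b, Integrable fun x => Real.exp (-V (b, x))) (hGm : Measurable G) (hG : ∀ b, ContDiff ℝ 1 fun x => G (b, x))
    (hGb : ∀ p, |G p| ≤ B₀)
    (hGlo : ∀ b (x y : EuclideanSpace ℝ (Fin n)), G (b, x) + ⟪gradient (fun z => G (b, z)) x, y - x⟫ - M / 2 * ‖y - x‖ ^ 2 ≤ G (b, y))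
    (hGup : ∀ b (x y : EuclideanSpace ℝ (Fin n)), G (b, y) ≤ G (b, x) + ⟪gradient (fun z => G (b, z)) x, y - x⟫ + M / 2 * ‖y - x‖ ^ 2)
    (hlM : l₀ * M < lam) (hs : |s| ≤ l₀) (hη : ∀ b, η b = (κ b).tilted fun x => s * G (b, x))
    (hFm : Measurable F) (hF : ∀ b, ContDiff ℝ 1 fun x => F (b, x)) (hFb : ∀ p, |F p| ≤ BF)
    (hFD : ∀ b x, ‖fderiv ℝ (fun z => F (b, z)) x‖ ≤ LF) (hLF : 0 < LF)
    (hbase : HasSubgaussianMGF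
      (fun b => (∫ x, F (b, x) ∂(η b)) - ∫ b', (∫ x, F (b', x) ∂(η b')) ∂(ν.tilted fun b => Real.log (∫ x, Real.exp (s * G (b, x)) ∂(κ b))))
      c (ν.tilted fun b => Real.log (∫ x, Real.exp (s * G (b, x)) ∂(κ b)))) (t : ℝ) :
    cgf F ((ν ⊗ₘ κ).tilted fun p => s * G p) t - t * ∫ q, F q ∂((ν ⊗ₘ κ).tilted fun p => s * G p) ≤
      (c + LF ^ 2 / (lam - l₀ * M)) * t ^ 2 / 2 := by
  have hfb : ∀ p : B × EuclideanSpace ℝ (Fin n), |s * G p| ≤ |s| * B₀ := fun p => by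
    rw [abs_mul]; exact mul_le_mul_of_nonneg_left (hGb p) (abs_nonneg _)
  haveI : IsProbabilityMeasure ((ν ⊗ₘ κ).tilted fun p => s * G p) :=
    isProbabilityMeasure_tilted ((integrable_const (Real.exp (|s| * B₀))).mono'
      (Real.measurable_exp.comp (hGm.const_mul s)).aestronglyMeasurable (Eventually.of_forall fun p => by
        rw [Real.norm_eq_abs, abs_of_pos (Real.exp_pos _), Real.exp_le_exp]; exact (le_abs_self _).trans (hfb p)))
  have h := bornCumulant_le_of_hasSubgaussianMGF (hasSubgaussianMGF_tilted_compProd_of_uniformlyConvex hκ hVc hV hZ hGm hG hGb hGlo hGup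
    hlM hs hη hFm hF hFb hFD hLF hbase) t
  exact_mod_cast h

end TiltedStep

/-! ## §3 Sub-Gaussian ⇒ variance: the socket's tilted-variance letter for the composite law -/
section Variance

variable {Ω : Type*} [MeasurableSpace Ω] {μ : Measure Ω} [IsProbabilityMeasure μ] {X : Ω → ℝ} {c : ℝ≥0}

/-- **A SUB-GAUSSIAN VARIABLE HAS SECOND MOMENT AT MOST ITS PARAMETER** [folklore; not in Mathlib].  `HasSubgaussianMGF X c μ` (Mathlib's
normalisation `mgf ≤ e^{ct²∕2}`) ⇒ `∫ X² dμ ≤ c`: average the two tilts `±t`, use `1 + (tX)²∕2 ≤ cosh(tX)`, so `(t²∕2)∫X² ≤ e^{ct²∕2} − 1 ≤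
ct²∕2 + (ct²∕2)²` for `ct²∕2 ≤ 1`, and let `t → 0`. -/
theorem integral_sq_le_of_hasSubgaussianMGF (h : HasSubgaussianMGF X c μ) : ∫ ω, X ω ^ 2 ∂μ ≤ c := by
  have hX2 : Integrable (fun ω => X ω ^ 2) μ := (h.memLp 2).integrable_sq
  have hc0 : 0 ≤ (c : ℝ) := c.coe_nonneg
  -- for every `0 < t` with `c t² / 2 ≤ 1`: `∫ X² ≤ c + c² t² / 2`
  have key : ∀ t : ℝ, 0 < t → (c : ℝ) * t ^ 2 / 2 ≤ 1 → ∫ ω, X ω ^ 2 ∂μ ≤ c + (c : ℝ) ^ 2 * t ^ 2 / 2 := by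
    intro t ht hy
    set y : ℝ := (c : ℝ) * t ^ 2 / 2 with hy_def
    have hy0 : 0 ≤ y := by positivity
    -- integrate `1 + (tX)²/2 ≤ (e^{tX} + e^{−tX})/2`
    have hint : Integrable (fun ω => (Real.exp (t * X ω) + Real.exp (-t * X ω)) / 2) μ :=
      ((h.integrable_exp_mul t).add (h.integrable_exp_mul (-t))).div_const 2
    have hlow : Integrable (fun ω => (1 : ℝ) + t ^ 2 / 2 * X ω ^ 2) μ := (integrable_const (1 : ℝ)).add (hX2.const_mul (t ^ 2 / 2))
    -- pointwise `1 + (tX)²/2 ≤ cosh (tX)`: the even power series of `cosh` has nonnegative terms (cf. the tree's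
    -- `DeBruijn1950.one_add_sq_div_two_le_cosh`, not imported to keep the complex-analysis cone out)
    have hcosh : ∀ r : ℝ, 1 + r ^ 2 / 2 ≤ (Real.exp r + Real.exp (-r)) / 2 := fun r => by
      rw [← Real.cosh_eq]
      have h := sum_le_hasSum (Finset.range 2)
        (fun i _ => div_nonneg (by rw [pow_mul]; exact pow_nonneg (sq_nonneg r) i) (Nat.cast_nonneg _)) (Real.hasSum_cosh r)
      simpa [Finset.sum_range_succ, Nat.factorial] using h
    have hmono := integral_mono hlow hint fun ω => by
      have := hcosh (t * X ω)
      show (1 : ℝ) + t ^ 2 / 2 * X ω ^ 2 ≤ (Real.exp (t * X ω) + Real.exp (-t * X ω)) / 2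
      rw [neg_mul]
      nlinarith [this]
    have hL : ∫ ω, (1 : ℝ) + t ^ 2 / 2 * X ω ^ 2 ∂μ = 1 + t ^ 2 / 2 * ∫ ω, X ω ^ 2 ∂μ := by
      rw [integral_add (integrable_const _) (hX2.const_mul _), integral_const_mul]
      simp
    have hR : ∫ ω, (Real.exp (t * X ω) + Real.exp (-t * X ω)) / 2 ∂μ ≤ Real.exp y := by
      rw [integral_div, integral_add (h.integrable_exp_mul t) (h.integrable_exp_mul (-t))]
      have h1 := h.mgf_le t
      have h2 := h.mgf_le (-t)
      rw [mgf] at h1 h2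
      have e2 : (c : ℝ) * (-t) ^ 2 / 2 = y := by rw [hy_def]; ring
      rw [e2] at h2
      rw [show (c : ℝ) * t ^ 2 / 2 = y from rfl] at h1
      linarith
    have hexp : Real.exp y - 1 ≤ y + y ^ 2 := by
      have := (abs_le.1 (Real.abs_exp_sub_one_sub_id_le (x := y) (by rw [abs_of_nonneg hy0]; exact hy))).2
      linarith
    rw [hL] at hmono
    have hmain : t ^ 2 / 2 * ∫ ω, X ω ^ 2 ∂μ ≤ y + y ^ 2 := by linarith
    -- divide by `t²/2`
    have ht2 : 0 < t ^ 2 / 2 := by positivity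
    rw [hy_def] at hmain
    have : ∫ ω, X ω ^ 2 ∂μ ≤ ((c : ℝ) * t ^ 2 / 2 + ((c : ℝ) * t ^ 2 / 2) ^ 2) / (t ^ 2 / 2) := by
      rw [le_div_iff₀ ht2]; linarith
    refine this.trans (le_of_eq ?_)
    field_simp
  refine le_of_forall_pos_le_add fun ε hε => ?_
  -- choose `t = min 1 (min (1/(c+1)) (ε/(c²+1)))`
  set t : ℝ := min 1 (min (1 / ((c : ℝ) + 1)) (ε / ((c : ℝ) ^ 2 + 1))) with ht_def
  have ht0 : 0 < t := by positivity
  have ht1 : t ≤ 1 := min_le_left _ _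
  have htc : t ≤ 1 / ((c : ℝ) + 1) := (min_le_right _ _).trans (min_le_left _ _)
  have htε : t ≤ ε / ((c : ℝ) ^ 2 + 1) := (min_le_right _ _).trans (min_le_right _ _)
  have ht2 : t ^ 2 ≤ t := by nlinarith
  have hy : (c : ℝ) * t ^ 2 / 2 ≤ 1 := by
    have h1 : (c : ℝ) * t ≤ (c : ℝ) * (1 / ((c : ℝ) + 1)) := mul_le_mul_of_nonneg_left htc hc0
    have h2 : (c : ℝ) * (1 / ((c : ℝ) + 1)) ≤ 1 := by
      rw [mul_one_div, div_le_one (by positivity)]; linarith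
    nlinarith
  have hε' : (c : ℝ) ^ 2 * t ^ 2 / 2 ≤ ε := by
    have h1 : (c : ℝ) ^ 2 * t ≤ (c : ℝ) ^ 2 * (ε / ((c : ℝ) ^ 2 + 1)) := mul_le_mul_of_nonneg_left htε (by positivity)
    have h2 : (c : ℝ) ^ 2 * (ε / ((c : ℝ) ^ 2 + 1)) ≤ ε := by
      rw [mul_div_assoc', div_le_iff₀ (by positivity)]; nlinarith
    nlinarith [sq_nonneg (c : ℝ)]
  exact (key t ht0 hy).trans (by linarith)

/-- **THE VARIANCE OF AN OBSERVABLE SUB-GAUSSIAN ABOUT ITS MEAN** [folklore]: `HasSubgaussianMGF (F − ∫F dμ) c μ` ⇒ `Var[F; μ] ≤ c`. -/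
theorem variance_le_of_hasSubgaussianMGF {F : Ω → ℝ} (hF : AEMeasurable F μ) (h : HasSubgaussianMGF (fun ω => F ω - ∫ z, F z ∂μ) c μ) :
    Var[F; μ] ≤ c := by
  rw [variance_eq_integral hF]
  exact integral_sq_le_of_hasSubgaussianMGF h

end Variance

section VarianceTilted

variable {B : Type*} [MeasurableSpace B] {n : ℕ} {ν : Measure B} [IsProbabilityMeasure ν]
  {κ η : Kernel B (EuclideanSpace ℝ (Fin n))} [IsMarkovKernel κ] [IsMarkovKernel η]
  {V G F : B × EuclideanSpace ℝ (Fin n) → ℝ} {lam M l₀ s B₀ BF LF : ℝ}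

/-- **THE VARIANCE SOCKET'S LETTER FOR THE TILTED COMPOSITE LAW** [folklore ∘ §2].  Under the hypotheses of
`hasSubgaussianMGF_tilted_compProd_of_uniformlyConvex`: `Var[F; (ν ⊗ₘ κ).tilted (s·G)] ≤ c + L_F²∕(λ − l₀M)` on the window — the tilted
variance `…N14VarianceSocket.tiltedMeanMatching_of_variance` reads (with `F = G` the socket's own observable), BOUNDED at tower level by the
base parameter plus the fibre's gradient constant. -/
theorem variance_tilted_compProd_le_of_uniformlyConvex {c : ℝ≥0}
    (hκ : ∀ b, κ b = (volume : Measure (EuclideanSpace ℝ (Fin n))).tilted fun x => -V (b, x))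
    (hVc : ∀ b, ContDiff ℝ 1 fun x => V (b, x))
    (hV : ∀ b (x y : EuclideanSpace ℝ (Fin n)), V (b, x) + ⟪gradient (fun z => V (b, z)) x, y - x⟫ + lam / 2 * ‖y - x‖ ^ 2 ≤ V (b, y))
    (hZ : ∀ b, Integrable fun x => Real.exp (-V (b, x))) (hGm : Measurable G) (hG : ∀ b, ContDiff ℝ 1 fun x => G (b, x))
    (hGb : ∀ p, |G p| ≤ B₀)
    (hGlo : ∀ b (x y : EuclideanSpace ℝ (Fin n)), G (b, x) + ⟪gradient (fun z => G (b, z)) x, y - x⟫ - M / 2 * ‖y - x‖ ^ 2 ≤ G (b, y))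
    (hGup : ∀ b (x y : EuclideanSpace ℝ (Fin n)), G (b, y) ≤ G (b, x) + ⟪gradient (fun z => G (b, z)) x, y - x⟫ + M / 2 * ‖y - x‖ ^ 2)
    (hlM : l₀ * M < lam) (hs : |s| ≤ l₀) (hη : ∀ b, η b = (κ b).tilted fun x => s * G (b, x))
    (hFm : Measurable F) (hF : ∀ b, ContDiff ℝ 1 fun x => F (b, x)) (hFb : ∀ p, |F p| ≤ BF)
    (hFD : ∀ b x, ‖fderiv ℝ (fun z => F (b, z)) x‖ ≤ LF) (hLF : 0 < LF)
    (hbase : HasSubgaussianMGF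
      (fun b => (∫ x, F (b, x) ∂(η b)) - ∫ b', (∫ x, F (b', x) ∂(η b')) ∂(ν.tilted fun b => Real.log (∫ x, Real.exp (s * G (b, x)) ∂(κ b))))
      c (ν.tilted fun b => Real.log (∫ x, Real.exp (s * G (b, x)) ∂(κ b)))) :
    Var[F; (ν ⊗ₘ κ).tilted fun p => s * G p] ≤ c + LF ^ 2 / (lam - l₀ * M) := by
  have hfb : ∀ p : B × EuclideanSpace ℝ (Fin n), |s * G p| ≤ |s| * B₀ := fun p => by
    rw [abs_mul]; exact mul_le_mul_of_nonneg_left (hGb p) (abs_nonneg _)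
  haveI : IsProbabilityMeasure ((ν ⊗ₘ κ).tilted fun p => s * G p) :=
    isProbabilityMeasure_tilted ((integrable_const (Real.exp (|s| * B₀))).mono'
      (Real.measurable_exp.comp (hGm.const_mul s)).aestronglyMeasurable (Eventually.of_forall fun p => by
        rw [Real.norm_eq_abs, abs_of_pos (Real.exp_pos _), Real.exp_le_exp]; exact (le_abs_self _).trans (hfb p)))
  have h := variance_le_of_hasSubgaussianMGF hFm.aemeasurable (hasSubgaussianMGF_tilted_compProd_of_uniformlyConvex hκ hVc hV hZ hGm hG
    hGb hGlo hGup hlM hs hη hFm hF hFb hFD hLF hbase)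
  exact_mod_cast h

end VarianceTilted

end YMDAG.N14.ConvexFibreTilt

end
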